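import Summits.Ventures.WeilGRH.GL2LevelLawParity
import HarnessLib

/-!
# GRH arm (rh-explicit, WeilGRH / GL₂-ext): named GL₂ levels with the parity bonus (weil-grh-2 gen6)

Numerical instances of `GL2LevelLawParity.weilPositivityOnGL2_of_weilPositivityOn_parity` at `β = −1/4`
(`1 − 2β² = 7/8`), unconditional for `t ≤ 4023/5000` (`EvenWinsBeyondArch.weilPositivityOn_of_le_8046`):
`(log 2)/2 ⇒ N ≥ 12`, `2/5 ⇒ 18`, `(log 3)/2 ⇒ 54`, `59/100 ⇒ 75`, `log 2 ⇒ 168`, `18/25 ⇒ 210`, `3/4 ⇒ 270`,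
`4023/5000 ⇒ 420` (`GL2LevelLaw`: 27 / 96 / 132 / 324 / 420 / 540 / 900; tree before gen6: 17 at `(log 2)/2`,
3 300 000 at the frontier); conditional `t = 1 ⇒ N ≥ 2430` (`GL2LevelLaw`: 6048).  The elementary inequalities use
`sinh t ≤ (U − U⁻¹)/2`, `tanh(t/2) ≤ (U − 1)/(U + 1)` for `e^t ≤ U` (`MinorantZetaTransfer`, `MinorantZetaTransferOddRungs`)
and the `log` bounds of `RungLogBounds`.  Everything PROVED; no definitions, no named facts.
-/

set_option autoImplicit false

noncomputable section

open Complex Set MeasureTheory Finset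
open scoped Real ArithmeticFunction.vonMangoldt

namespace Summit.Ventures.WeilGRH

open Literature.NumberTheory.LFunctions

/-! ## Named levels (`β = −1/4`, `1 − 2β² = 7/8`) -/

/-- Parity budgets at `β = −1/4`: `2/5 → 18`, `(log 3)/2 → 54`, `59/100 → 75`, `log 2 → 168`, `18/25 → 210`, `3/4 → 270`,
`4023/5000 → 420`, `1 → 2430`, `(log 2)/2 → 12`. [folklore] -/
theorem gl2_parity_budgets :
    4 * (Real.sinh (2 / 5) + 2 / 5 + 2 * (-1 / 4) * (2 / 5) + (-1 / 4) ^ 2 * Real.tanh (2 / 5 / 2)) ≤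
        (1 - 2 * (-1 / 4) ^ 2) * Real.log (18 : ℕ) ∧
    4 * (Real.sinh (Real.log 3 / 2) + Real.log 3 / 2 + 2 * (-1 / 4) * (Real.log 3 / 2) +
        (-1 / 4) ^ 2 * Real.tanh (Real.log 3 / 2 / 2)) ≤ (1 - 2 * (-1 / 4) ^ 2) * Real.log (54 : ℕ) ∧
    4 * (Real.sinh (59 / 100) + 59 / 100 + 2 * (-1 / 4) * (59 / 100) + (-1 / 4) ^ 2 * Real.tanh (59 / 100 / 2)) ≤
        (1 - 2 * (-1 / 4) ^ 2) * Real.log (75 : ℕ) ∧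
    4 * (Real.sinh (Real.log 2) + Real.log 2 + 2 * (-1 / 4) * Real.log 2 + (-1 / 4) ^ 2 * Real.tanh (Real.log 2 / 2)) ≤
        (1 - 2 * (-1 / 4) ^ 2) * Real.log (168 : ℕ) ∧
    4 * (Real.sinh (18 / 25) + 18 / 25 + 2 * (-1 / 4) * (18 / 25) + (-1 / 4) ^ 2 * Real.tanh (18 / 25 / 2)) ≤
        (1 - 2 * (-1 / 4) ^ 2) * Real.log (210 : ℕ) ∧
    4 * (Real.sinh (3 / 4) + 3 / 4 + 2 * (-1 / 4) * (3 / 4) + (-1 / 4) ^ 2 * Real.tanh (3 / 4 / 2)) ≤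
        (1 - 2 * (-1 / 4) ^ 2) * Real.log (270 : ℕ) ∧
    4 * (Real.sinh (4023 / 5000) + 4023 / 5000 + 2 * (-1 / 4) * (4023 / 5000) +
        (-1 / 4) ^ 2 * Real.tanh (4023 / 5000 / 2)) ≤ (1 - 2 * (-1 / 4) ^ 2) * Real.log (420 : ℕ) ∧
    4 * (Real.sinh 1 + 1 + 2 * (-1 / 4) * 1 + (-1 / 4) ^ 2 * Real.tanh (1 / 2)) ≤
        (1 - 2 * (-1 / 4) ^ 2) * Real.log (2430 : ℕ) ∧
    4 * (Real.sinh (Real.log 2 / 2) + Real.log 2 / 2 + 2 * (-1 / 4) * (Real.log 2 / 2) +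
        (-1 / 4) ^ 2 * Real.tanh (Real.log 2 / 2 / 2)) ≤ (1 - 2 * (-1 / 4) ^ 2) * Real.log (12 : ℕ) := by
  have s25 := sinh_le_of_exp_le exp_two_fifths_le; have t25 := tanh_half_le_of_exp_le exp_two_fifths_le
  have s3 := sinh_le_of_exp_le exp_log_three_half_le; have t3 := tanh_half_le_of_exp_le exp_log_three_half_le
  have s59 := sinh_le_of_exp_le exp_fiftynine_hundredths_le
  have t59 := tanh_half_le_of_exp_le exp_fiftynine_hundredths_le
  have tl2 := tanh_half_le_of_exp_le (le_of_eq (Real.exp_log (by norm_num : (0 : ℝ) < 2)))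
  have s72 := sinh_le_of_exp_le exp_eighteen_twentyfifths_le
  have t72 := tanh_half_le_of_exp_le exp_eighteen_twentyfifths_le
  have s75 := sinh_le_of_exp_le exp_three_quarters_le; have t75 := tanh_half_le_of_exp_le exp_three_quarters_le
  have sfr := sinh_le_of_exp_le (exp_frontier_bounds).2; have tfr := tanh_half_le_of_exp_le (exp_frontier_bounds).2
  have s1 := sinh_le_of_exp_le Real.exp_one_lt_d9.le; have t1 := tanh_half_le_of_exp_le Real.exp_one_lt_d9.le
  have sl22 := sinh_le_of_exp_le exp_log_two_half_le; have tl22 := tanh_half_le_of_exp_le exp_log_two_half_le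
  have hl2v := Real.log_two_gt_d9; have hl2u := Real.log_two_lt_d9; have hl3v := Real.log_three_gt_d9
  have hl3u := Real.log_three_lt_d9; have hl5v := Real.log_five_gt_d9; have h7 := log_seven_ge_quarter
  rw [sinh_log_two] at *; push_cast at *
  refine ⟨?_, ?_, ?_, ?_, ?_, ?_, ?_, ?_, ?_⟩
  · rw [show (18 : ℝ) = 2 * 3 ^ 2 by norm_num, Real.log_mul (by norm_num) (by norm_num), Real.log_pow]; push_cast
    nlinarith
  · rw [show (54 : ℝ) = 2 * 3 ^ 3 by norm_num, Real.log_mul (by norm_num) (by norm_num), Real.log_pow]; push_cast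
    nlinarith
  · rw [show (75 : ℝ) = 3 * 5 ^ 2 by norm_num, Real.log_mul (by norm_num) (by norm_num), Real.log_pow]; push_cast
    nlinarith
  · rw [show (168 : ℝ) = 2 ^ 3 * 3 * 7 by norm_num, Real.log_mul (by norm_num) (by norm_num),
      Real.log_mul (by norm_num) (by norm_num), Real.log_pow]; push_cast
    nlinarith
  · rw [show (210 : ℝ) = 2 * 3 * 5 * 7 by norm_num, Real.log_mul (by norm_num) (by norm_num),
      Real.log_mul (by norm_num) (by norm_num), Real.log_mul (by norm_num) (by norm_num)]
    nlinarith
  · rw [show (270 : ℝ) = 2 * 3 ^ 3 * 5 by norm_num, Real.log_mul (by norm_num) (by norm_num),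
      Real.log_mul (by norm_num) (by norm_num), Real.log_pow]; push_cast
    nlinarith
  · rw [show (420 : ℝ) = 2 ^ 2 * 3 * 5 * 7 by norm_num, Real.log_mul (by norm_num) (by norm_num),
      Real.log_mul (by norm_num) (by norm_num), Real.log_mul (by norm_num) (by norm_num), Real.log_pow]; push_cast
    nlinarith
  · rw [show (2430 : ℝ) = 2 * 3 ^ 5 * 5 by norm_num, Real.log_mul (by norm_num) (by norm_num),
      Real.log_mul (by norm_num) (by norm_num), Real.log_pow]; push_cast
    nlinarith
  · rw [show (12 : ℝ) = 2 ^ 2 * 3 by norm_num, Real.log_mul (by norm_num) (by norm_num), Real.log_pow]; push_cast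
    nlinarith

/-- ★ **GL₂ levels with the parity bonus (unconditional, `t ≤ 4023/5000`)**: `log 2 ⇒ N ≥ 168`, `4023/5000 ⇒ N ≥ 420`,
`3/4 ⇒ 270`, `18/25 ⇒ 210`, `59/100 ⇒ 75`, `(log 3)/2 ⇒ 54`, `2/5 ⇒ 18`, `(log 2)/2 ⇒ 12` (even `k ≥ 2`, `‖Λf n‖ ≤ 2Λ(n)`).
[cite: IwaniecKowalski2004, §5.5 Thm 5.12 (5.45)] -/
theorem weilPositivityOnGL2_parity_rungs {k N : ℕ} {Λf : ℕ → ℂ} (hk : Even k) (hk2 : 2 ≤ k)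
    (hΛ : ∀ n, ‖Λf n‖ ≤ 2 * Λ n) :
    (168 ≤ N → WeilPositivityOnGL2 k N Λf (Real.log 2)) ∧ (420 ≤ N → WeilPositivityOnGL2 k N Λf (4023 / 5000)) ∧
      (270 ≤ N → WeilPositivityOnGL2 k N Λf (3 / 4)) ∧ (210 ≤ N → WeilPositivityOnGL2 k N Λf (18 / 25)) ∧
      (75 ≤ N → WeilPositivityOnGL2 k N Λf (59 / 100)) ∧ (54 ≤ N → WeilPositivityOnGL2 k N Λf (Real.log 3 / 2)) ∧
      (18 ≤ N → WeilPositivityOnGL2 k N Λf (2 / 5)) ∧ (12 ≤ N → WeilPositivityOnGL2 k N Λf (Real.log 2 / 2)) := by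
  obtain ⟨b25, b3, b59, bl2, b72, b75, bfr, -, bl22⟩ := gl2_parity_budgets
  have hβ : 2 * (-1 / 4 : ℝ) ^ 2 < 1 := by norm_num
  have Z := fun {t : ℝ} (htf : t ≤ 4023 / 5000) ↦
    Summit.RiemannHypothesis.RiemannHypothesis.Theorems.EvenWinsBeyondArch.weilPositivityOn_of_le_8046 htf
  refine ⟨fun h ↦ ?_, fun h ↦ ?_, fun h ↦ ?_, fun h ↦ ?_, fun h ↦ ?_, fun h ↦ ?_, fun h ↦ ?_, fun h ↦ ?_⟩
  · exact weilPositivityOnGL2_of_weilPositivityOn_parity_of_le hk hk2 hΛ (Real.log_pos (by norm_num))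
      (Z (by linarith [Real.log_two_lt_d9])) hβ (by norm_num) bl2 h
  · exact weilPositivityOnGL2_of_weilPositivityOn_parity_of_le hk hk2 hΛ (by norm_num) (Z le_rfl) hβ (by norm_num) bfr h
  · exact weilPositivityOnGL2_of_weilPositivityOn_parity_of_le hk hk2 hΛ (by norm_num) (Z (by norm_num)) hβ
      (by norm_num) b75 h
  · exact weilPositivityOnGL2_of_weilPositivityOn_parity_of_le hk hk2 hΛ (by norm_num) (Z (by norm_num)) hβ
      (by norm_num) b72 h
  · exact weilPositivityOnGL2_of_weilPositivityOn_parity_of_le hk hk2 hΛ (by norm_num) (Z (by norm_num)) hβ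
      (by norm_num) b59 h
  · exact weilPositivityOnGL2_of_weilPositivityOn_parity_of_le hk hk2 hΛ (by linarith [Real.log_three_gt_d9])
      (Z (by linarith [Real.log_three_lt_d9])) hβ (by norm_num) b3 h
  · exact weilPositivityOnGL2_of_weilPositivityOn_parity_of_le hk hk2 hΛ (by norm_num) (Z (by norm_num)) hβ
      (by norm_num) b25 h
  · exact weilPositivityOnGL2_of_weilPositivityOn_parity_of_le hk hk2 hΛ (by linarith [Real.log_two_gt_d9])
      (Z (by linarith [Real.log_two_lt_d9])) hβ (by norm_num) bl22 h

/-- **CONDITIONAL `t = 1`**: `WeilPositivityOn 1 →` window `[-1, 1]` for every GL₂ datum of level `N ≥ 2430`. [folklore] -/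
theorem weilPositivityOnGL2_one_of_weilPositivityOn_one_parity {k N : ℕ} {Λf : ℕ → ℂ} (hk : Even k) (hk2 : 2 ≤ k)
    (hΛ : ∀ n, ‖Λf n‖ ≤ 2 * Λ n) (hζ : WeilPositivityOn 1) (hN : 2430 ≤ N) : WeilPositivityOnGL2 k N Λf 1 :=
  weilPositivityOnGL2_of_weilPositivityOn_parity_of_le hk hk2 hΛ one_pos hζ (by norm_num) (by norm_num)
    gl2_parity_budgets.2.2.2.2.2.2.2.1 hN

/-- **`t = 1` from a CERTIFIED GROUND-ENERGY BOUND**: `−δ ≤ weilGroundEnergy 1` and `log 2430 + 2δ ≤ log N` ⇒ the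
window `[-1, 1]` for every GL₂ datum of level `N` (even `k ≥ 2`, `‖Λf n‖ ≤ 2Λ(n)`); `δ = 0` is the conditional rung. [folklore] -/
theorem weilPositivityOnGL2_one_of_groundEnergy_ge_parity {k N : ℕ} {Λf : ℕ → ℂ} (hk : Even k) (hk2 : 2 ≤ k)
    (hΛ : ∀ n, ‖Λf n‖ ≤ 2 * Λ n) {δ : ℝ} (hδ : -δ ≤ weilGroundEnergy 1)
    (hN : Real.log 2430 + 2 * δ ≤ Real.log N) : WeilPositivityOnGL2 k N Λf 1 := by
  have b := gl2_parity_budgets.2.2.2.2.2.2.2.1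
  refine weilPositivityOnGL2_of_groundEnergy_parity hk hk2 hΛ one_pos (β := -1 / 4) (by norm_num) ?_
  norm_num at b ⊢
  nlinarith [b, hδ, hN]

end Summit.Ventures.WeilGRH

end
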